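import Mathlib
import Literature.Analysis.FluidPDE.TypeIAncientMild
import Literature.Analysis.FluidPDE.TypeIAncientMildClassical
import Literature.Analysis.FluidPDE.ChaeAsymptoticallySelfSimilarProfile
import Literature.Analysis.FluidPDE.TsaiSelfSimilarBounded
import HarnessLib

/-!
# Leray's reduction on a window + Tsai: a window-self-similar Type-I ancient mild field has a
# constant slice

Crux `RecurrentLiouville` (stmt-NavierStokesRegularity-1589), line `Sketch`, skeleton v6
(Giga–Kohn harvest), stub S4 `stub_gkWindowLeray`.  Theorems-only file (no definitions, no named
facts).

Let `W ∈ IsTypeIAncientMild C` (jointly smooth on `t < 0`, divergence free, Oseen-mild between all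
pairs of negative times, `‖W(t, x)‖ ≤ C/√(−t)`) be scale invariant ON A WINDOW only:
`c W(c² t, c x) = W(t, x)` for the factors `1 ≤ c`, `c² ≤ 2`, the times `t ∈ (−2, −1)` and all `x`.
Then the slice `W(−3/2)` is spatially constant (`stub_gkWindowLeray`).

Proof (the window version of the tree's `stub_rlSelfSimilarMildVanishes`).
* On the window `W` IS Leray's backward self-similar field of its slice at the normalised time
  `−3/2`, with rate `a = 1/3` and epoch `T = 0`: `W s = lerayBackward (1/3) 0 (W(−3/2)) s` for
  `s ∈ (−2, −1)` (`gkLeray_eq_lerayBackward`).  With `μ = √(−2s/3) ∈ (√(2/3), √(4/3))` one wants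
  `W(s, y) = μ⁻¹ W(−3/2, μ⁻¹ y)`; if `μ ≥ 1` this is the hypothesis with `c = μ` at time `−3/2`
  and the point `μ⁻¹ y` (`μ²(−3/2) = s`), and if `μ < 1` it is the hypothesis with `c = μ⁻¹` at
  time `s` (`μ⁻² s = −3/2`, `μ⁻² = 3/(−2s) ≤ 3/2`).
* `IsTypeIAncientMild.exists_isClassicalNSSolutionOn_Ioo` gives a smooth pressure `π` with
  `(W, π)` classical on `(−2, 0)`, hence on `(−2, −1)` (`IsClassicalNSSolutionOn.mono`), hence —
  rebuilding the classical record field by field for Leray's field, which agrees with `W` at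
  every time of the window — `(lerayBackward (1/3) 0 (W(−3/2)), π)` is classical on `(−2, −1)`.
* Leray's reduction at the interior normalised time `0 − (2·(1/3))⁻¹ = −3/2`
  (`isLerayProfile_of_isClassical_lerayBackward`): `(W(−3/2), π(−3/2))` is a Leray profile with
  `ν = 1`, `a = 1/3`; it is bounded by `C/√(3/2)` (the Type I rate at `t = −3/2`), hence
  constant (Tsai 1998, Theorem 1, `q = ∞`: `IsLerayProfile.exists_eq_const_of_bounded`).

## References

* J. Leray, Acta Math. 63 (1934), §20, (3.11)–(3.12). [Leray1934]
* T.-P. Tsai, Arch. Rational Mech. Anal. 143 (1998) 29–51, Theorem 1 (p. 31). [Tsai1998]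
-/

noncomputable section

-- the sub-problem namespace repeats the summit name (D-0017 layout `Summit.<S>.<P>.Theorems`)
set_option linter.dupNamespace false

namespace Summit.NavierStokesRegularity.NavierStokesRegularity.Theorems

open MeasureTheory Set Function Filter Topology TopologicalSpace Metric
open Literature.Analysis Literature.Analysis.FluidPDE
open scoped NNReal ENNReal

/-! ### Scale invariance on the window `(−2, −1)` is Leray's backward ansatz with rate `1/3` -/

/-- **Leray form on the window.**  A field `W` with `c W(c² t, c x) = W(t, x)` for all factors
`1 ≤ c`, `c² ≤ 2`, all `t ∈ (−2, −1)` and all `x` is, on that window, Leray's backward ansatz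
(`T = 0`, rate `a = 1/3`, normalised time `−3/2`) of its slice at `t = −3/2`:
`W s = lerayBackward (1/3) 0 (W(−3/2)) s` for `s ∈ (−2, −1)`, i.e.
`W(s, y) = μ⁻¹ W(−3/2, μ⁻¹ y)` with `μ = √(−2s/3)`.  For `μ ≥ 1` (`s ≤ −3/2`) take `c = μ` at time
`−3/2` and the point `μ⁻¹ y` (`μ² ≤ 4/3 ≤ 2`, `μ²(−3/2) = s`); for `μ < 1` take `c = μ⁻¹` at time
`s` and the point `y` (`μ⁻² = 3/(−2s) ≤ 3/2 ≤ 2`, `μ⁻² s = −3/2`) (Leray 1934, (3.11)).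
[cite: Leray1934, §20 (3.11)–(3.12)] -/
theorem gkLeray_eq_lerayBackward
    {W : ℝ → EuclideanSpace ℝ (Fin 3) → EuclideanSpace ℝ (Fin 3)}
    (hss : ∀ c : ℝ, 1 ≤ c → c ^ 2 ≤ 2 → ∀ t ∈ Ioo (-2 : ℝ) (-1), ∀ x : EuclideanSpace ℝ (Fin 3),
      nsRescale c W t x = W t x)
    {s : ℝ} (hs : s ∈ Ioo (-2 : ℝ) (-1)) : W s = lerayBackward (1 / 3) 0 (W (-3 / 2)) s := by
  funext y
  have hs1 : -2 < s := hs.1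
  have hs2 : s < -1 := hs.2
  have hpos : 0 < 2 * (1 / 3) * (0 - s) := by linarith
  -- the scale factor `μ = √(2 · (1/3) · (0 − s))` of Leray's ansatz at time `s`
  obtain ⟨μ, hμ0, hμ2, hμ⟩ : ∃ μ : ℝ, 0 < μ ∧ μ ^ 2 = 2 * (1 / 3) * (0 - s) ∧
      Real.sqrt (2 * (1 / 3) * (0 - s)) = μ :=
    ⟨_, Real.sqrt_pos.2 hpos, Real.sq_sqrt hpos.le, rfl⟩
  rw [lerayBackward_apply, hμ]
  rcases le_or_gt 1 μ with h1 | h1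
  · -- `1 ≤ μ`: factor `c = μ`, time `-3/2`, point `μ⁻¹ • y`
    have hc2 : μ ^ 2 ≤ 2 := by
      rw [hμ2]
      linarith
    have hmem : (-3 / 2 : ℝ) ∈ Ioo (-2 : ℝ) (-1) := by
      rw [mem_Ioo]
      norm_num
    have key := hss μ h1 hc2 (-3 / 2) hmem (μ⁻¹ • y)
    rw [nsRescale_apply, smul_smul, mul_inv_cancel₀ hμ0.ne', one_smul] at key
    have e : μ ^ 2 * (-3 / 2) = s := by
      rw [hμ2]
      ring
    rw [e] at key
    rw [← key, smul_smul, inv_mul_cancel₀ hμ0.ne', one_smul]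
  · -- `μ < 1`: factor `c = μ⁻¹`, time `s`, point `y`
    have h1' : 1 ≤ μ⁻¹ := (one_le_inv₀ hμ0).2 h1.le
    have hμ2pos : 0 < μ ^ 2 := by positivity
    have hc2 : μ⁻¹ ^ 2 ≤ 2 := by
      rw [inv_pow, ← one_div, div_le_iff₀ hμ2pos, hμ2]
      linarith
    have key := hss μ⁻¹ h1' hc2 s hs y
    rw [nsRescale_apply] at key
    have e : μ⁻¹ ^ 2 * s = -3 / 2 := by
      rw [inv_pow, hμ2, inv_mul_eq_div, div_eq_iff hpos.ne']
      ring
    rw [e] at key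
    exact key.symm

/-! ### The stub -/

/-- **Window Leray.**  A Type-I ancient mild field `W` (`IsTypeIAncientMild C W`) which is scale
invariant on the window `(−2,−1)` for the factors `1 ≤ c`, `c² ≤ 2` — `c W(c²t, cx) = W(t,x)` — has
a CONSTANT slice at `t = −3/2`: on the window `W = lerayBackward (1/3) 0 (W(−3/2))` (Leray's ansatz
with rate `a = 1/3`, normalised time `−3/2`; `gkLeray_eq_lerayBackward`), `(W, π)` is classical
there for a smooth pressure (`IsTypeIAncientMild.exists_isClassicalNSSolutionOn_Ioo` on `(−2, 0)`,
restricted by `IsClassicalNSSolutionOn.mono`, the velocity switched to Leray's field clause by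
clause), so `W(−3/2)` is a Leray profile (`isLerayProfile_of_isClassical_lerayBackward`, `ν = 1`,
`a = 1/3`) bounded by the rate `C/√(3/2)`, hence constant (Tsai 1998 Thm 1, `q = ∞`:
`IsLerayProfile.exists_eq_const_of_bounded`).
[cite: Tsai1998, Thm 1 (p. 31)]
[cite: Leray1934, §20 (3.11)–(3.12)] -/
theorem stub_gkWindowLeray :
    ∀ (C : ℝ) (W : ℝ → EuclideanSpace ℝ (Fin 3) → EuclideanSpace ℝ (Fin 3)),
      IsTypeIAncientMild C W →
      (∀ c : ℝ, 1 ≤ c → c ^ 2 ≤ 2 → ∀ t ∈ Ioo (-2 : ℝ) (-1), ∀ x : EuclideanSpace ℝ (Fin 3),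
        nsRescale c W t x = W t x) →
      ∃ b : EuclideanSpace ℝ (Fin 3), ∀ x : EuclideanSpace ℝ (Fin 3), W (-3 / 2) x = b := by
  intro C W hW hss
  -- a smooth pressure making `(W, π)` classical on `(-2, 0)`, hence on the window `(-2, -1)`
  obtain ⟨π, hcl⟩ := hW.exists_isClassicalNSSolutionOn_Ioo (t₀ := -2) (by norm_num)
  have hcl₁ : IsClassicalNSSolutionOn (Ioo (-2 : ℝ) (-1)) 1 0 W π :=
    hcl.mono (Ioo_subset_Ioo_right (by norm_num)) isOpen_Ioo.uniqueDiffOn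
  -- on the window `W` IS Leray's backward field of its smooth slice `U = W (-3/2)`
  have hwt : ∀ s ∈ Ioo (-2 : ℝ) (-1), W s = lerayBackward (1 / 3) 0 (W (-3 / 2)) s :=
    fun s hs => gkLeray_eq_lerayBackward hss hs
  have hcl' : IsClassicalNSSolutionOn (Ioo (-2 : ℝ) (-1)) 1 0
      (lerayBackward (1 / 3) 0 (W (-3 / 2))) π :=
    { smooth_velocity := hcl₁.smooth_velocity.congr fun q hq => by
        change lerayBackward (1 / 3) 0 (W (-3 / 2)) q.1 q.2 = W q.1 q.2
        rw [hwt q.1 (mem_prod.1 hq).1]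
      smooth_pressure := hcl₁.smooth_pressure
      momentum := fun s hs y => by
        have h1 : timeDerivWithin (Ioo (-2 : ℝ) (-1)) (lerayBackward (1 / 3) 0 (W (-3 / 2))) s y =
            timeDerivWithin (Ioo (-2 : ℝ) (-1)) W s y := by
          simp only [timeDerivWithin]
          exact derivWithin_congr (fun r hr => by rw [hwt r hr]) (by rw [hwt s hs])
        rw [h1, ← hwt s hs]
        exact hcl₁.momentum s hs y
      divFree := fun s hs => by
        rw [← hwt s hs]
        exact hcl₁.divFree s hs }
  -- Leray's reduction at the normalised time `0 - (2 * (1/3))⁻¹ = -3/2`, interior to the window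
  have hint : (0 : ℝ) - (2 * (1 / 3))⁻¹ ∈ interior (Ioo (-2 : ℝ) (-1)) := by
    rw [interior_Ioo, mem_Ioo]
    norm_num
  have hprof : IsLerayProfile 1 (1 / 3) (W (-3 / 2)) (π (0 - (2 * (1 / 3))⁻¹)) :=
    isLerayProfile_of_isClassical_lerayBackward (by norm_num : (0 : ℝ) < 1 / 3)
      (hW.contDiff_slice (by norm_num)) hint hcl'
  -- the profile is bounded by the Type I rate at `t = -3/2`, hence constant (Tsai 1998, Thm 1)
  exact hprof.exists_eq_const_of_bounded one_pos (by norm_num)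
    ⟨C / Real.sqrt (-(-3 / 2)), fun y => hW.norm_le (by norm_num) y⟩

end Summit.NavierStokesRegularity.NavierStokesRegularity.Theorems
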